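import Summits.HubbardSuperconductivity.HubbardSuperconductivity.Theorems.BalabanIRBirComplexStableXYRHolonomyTheta
import Literature.MathematicalPhysics.QuantumFieldTheory.TiltedThetaSeriesPositivity
import HarnessLib

/-!
# Crux `BirComplexStableXYR` (stmt-HubbardSuperconductivity-14845), line `fat-gaussian-defect-calculus`, chapter 2
# §2.1: the Gaussian flux-sector series with its Berry phase is a positive real

Support file (prover seat 1, route BalabanIR; item G2 "Coulomb strain σ_a", holonomy part — conclusion).

The line card (§2.1, CAUTION) records that the vortex-free sectors of lead c7's representation carry, besides the
Gaussian cost `exp(−(K/2)𝒬(σ(seam h)))`, the Berry phase `exp(iK τ·h)` (stub D1), so that the `h`-series is a TILTED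
theta series which "is exactly positive at the Gaussian level but possibly exponentially smaller than the untilted sum".
This file makes the positivity a theorem, for every admissible table and uniformly in everything:

* **`stub_fluxThetaPositive`** (registered stub): for a table with `Σ c_n = 0` and coercivity (C) at range `r ≥ 2` and
  ANY strain map `σ` with the two properties of `FSUnfolding.stub_fsRepresentation`, the stiffness matrix `S` of
  `stub_holonomyQuadraticForm` (`𝒬(σ(seam h)) = hᵀSh` on `ℤ³`, flux lower bound, constant-twist upper bound, linearity
  of functionals) is moreover COERCIVE ON `ℝ³` — `8π²c₀|Λ|(x₀²/L² + x₁²/L² + x₂²/M²) ≤ xᵀSx` — hence positive definite,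
  and for every `K > 0` and every real `τ`
  `0 < Σ_{h ∈ ℤ³} exp(−(K/2)·𝒬(σ(seam h))) · cos(τ·h)`
  (Literature `GaussianPoisson.tsum_exp_neg_half_form_mul_cos_pos`: tilted theta series of positive definite forms are
  positive in every rank, by the theta transformation of `GaussianPoissonZn`).

No definitions; sorry-free. [folklore: Fröhlich–Spencer, CMP 83 (1982) §2.6 (Poisson dual of the flux sectors)]
-/

noncomputable section

namespace Summit.HubbardSuperconductivity.HubbardSuperconductivity.Theorems

set_option linter.dupNamespace false -- summit = problem name (single-conjunct summit), D-0017

open scoped BigOperators ComplexConjugate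
open Complex Matrix Summit.HubbardSuperconductivity.BirComplexStableXYNegative
open Literature.Probability.LatticeModels Literature.MathematicalPhysics.QuantumFieldTheory

section FluxThetaPositive

variable {r : ℕ} {L M : ℕ} [NeZero L] [NeZero M]

/-- The column totals of the unit strains: `Σ_y σ(seam e_i)(y, μ) = 2π|Λ| (e_i)_μ / N_μ`. [folklore] -/
theorem ftp_sum_unitStrain
    (σ : {a : Λ L M → Fin 3 → ℤ // ∀ (y : Λ L M) (μ : Fin 3),
      (∀ ν : Fin 3, μ < ν → (TorusChart.piProdZMod 2 L M).cval ν y = 0) →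
      (TorusChart.piProdZMod 2 L M).cval μ y + 1 < (TorusChart.piProdZMod 2 L M).period μ → a y μ = 0} →
      (Λ L M → Fin 3 → ℝ))
    (hcls : ∀ a, ∃ ψ : Λ L M → ℝ, σ a = fun x i => 2 * Real.pi * (a.1 x i : ℝ) - (TorusChart.piProdZMod 2 L M).d₀ ψ x i)
    (i μ : Fin 3) :
    ∑ y : Λ L M, σ ⟨(TorusChart.piProdZMod 2 L M).seam (Pi.single i (1 : ℤ)), hth_seam_comb (Pi.single i (1 : ℤ))⟩ y μ
      = 2 * Real.pi * ((Fintype.card (Λ L M) : ℝ) * (((Pi.single i (1 : ℤ) : Fin 3 → ℤ) μ : ℤ) : ℝ)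
          / ((TorusChart.piProdZMod 2 L M).period μ : ℝ)) := by
  obtain ⟨ψ, hψ⟩ := hcls ⟨(TorusChart.piProdZMod 2 L M).seam (Pi.single i (1 : ℤ)), hth_seam_comb (Pi.single i (1 : ℤ))⟩
  rw [hψ]
  have h1 := scl_sum_eq_of_exact_shift (TorusChart.piProdZMod 2 L M)
    ((TorusChart.piProdZMod 2 L M).seam (Pi.single i (1 : ℤ))) ψ μ
  have h2 := scl_sum_intCast_of_d₁_eq_zero (TorusChart.piProdZMod 2 L M)
    ((TorusChart.piProdZMod 2 L M).seam (Pi.single i (1 : ℤ))) ((TorusChart.piProdZMod 2 L M).d₁_seam _) μ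
  rw [(TorusChart.piProdZMod 2 L M).wind_seam] at h2
  rw [h1, h2]

/-- **Registered stub `stub_fluxThetaPositive` (prover seat 1 on stmt-HubbardSuperconductivity-14845; chapter 2 §2.1):
the Gaussian flux-sector series with its Berry phase is a positive real.**  Hypotheses as in
`stub_holonomyQuadraticForm`.  Conclusion: a symmetric real `3 × 3` matrix `S` with (1) `𝒬(σ(seam h)) = Σ S_{ij}h_ih_j`
on `ℤ³`, (2) the flux lower bound and (3) the constant-twist upper bound on `ℤ³`, (4) linearity of real-linear
functionals of the strain in `h`, (5) coercivity on `ℝ³`: `8π²c₀|Λ|(x₀²/L² + x₁²/L² + x₂²/M²) ≤ Σ S_{ij}x_ix_j`,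
(6) `S` is positive definite, and (7) for every `K > 0` and real `τ`:
`0 < Σ_{h∈ℤ³} exp(−(K/2)𝒬(σ(seam h))) cos(τ·h)`. [folklore] -/
theorem stub_fluxThetaPositive : ∀ (r : ℕ) (c : Table r) (c₀ : ℝ), 2 ≤ r → 0 < c₀ → c.sum (fun _ a => a) = 0 → (∀ φ : W r → ℝ, c₀ * ∑ w, ∑ w', (1 - Real.cos (φ w - φ w')) ≤ (genF c φ).re) → ∀ (L M : ℕ) [NeZero L] [NeZero M] (P : (Λ L M → Fin 3 → ℝ) → Λ L M → W r → ℝ), (∀ (ω : Λ L M → Fin 3 → ℝ) (s : Λ L M) (w : W r), P ω s w = (Literature.MathematicalPhysics.QuantumFieldTheory.TorusChart.piProdZMod 2 L M).lineSum ω 0 (w.1 : ℕ) s + (Literature.MathematicalPhysics.QuantumFieldTheory.TorusChart.piProdZMod 2 L M).lineSum ω 1 (w.2.1 : ℕ) (s + (w.1 : ℕ) • (Literature.MathematicalPhysics.QuantumFieldTheory.TorusChart.piProdZMod 2 L M).gen 0) + (Literature.MathematicalPhysics.QuantumFieldTheory.TorusChart.piProdZMod 2 L M).lineSum ω 2 (w.2.2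 : ℕ) (s + (w.1 : ℕ) • (Literature.MathematicalPhysics.QuantumFieldTheory.TorusChart.piProdZMod 2 L M).gen 0 + (w.2.1 : ℕ) • (Literature.MathematicalPhysics.QuantumFieldTheory.TorusChart.piProdZMod 2 L M).gen 1)) → ∀ (Q : (W r → ℝ) → ℝ), (∀ u : W r → ℝ, Q u = (-c.sum (fun n a => a * (((∑ w, (n w : ℝ) * u w) ^ 2 : ℝ) : ℂ))).re) → ∀ (σ : {a : Λ L M → Fin 3 → ℤ // ∀ (y : Λ L M) (μ : Fin 3), (∀ ν : Fin 3, μ < ν → (Literature.MathematicalPhysics.QuantumFieldTheory.TorusChart.piProdZMod 2 L M).cval ν y = 0) → (Literature.MathematicalPhysics.QuantumFieldTheory.TorusChart.piProdZMod 2 L M).cval μ y + 1 < (Literature.MathematicalPhysics.QuantumFieldTheory.TorusChart.piProdZMod 2 L M).period μ → a y μ = 0} → (Λ L M → Fin 3 → ℝ)), (∀ a, ∃ ψ : Λ L M → ℝ, σ a = fun x i => 2 * Real.pi * (a.1 x i : ℝ) - (Literature.MathematicalPhysics.QuantumFieldTheory.TorusChart.piProdZMod 2 L M).d₀ ψ x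 i) → (∀ a (u : Λ L M → ℝ), ∑ s : Λ L M, Q (P (fun x i => (Literature.MathematicalPhysics.QuantumFieldTheory.TorusChart.piProdZMod 2 L M).d₀ u x i - σ a x i) s) = ∑ s : Λ L M, Q (P ((Literature.MathematicalPhysics.QuantumFieldTheory.TorusChart.piProdZMod 2 L M).d₀ u) s) + ∑ s : Λ L M, Q (P (σ a) s)) → ∃ S : Fin 3 → Fin 3 → ℝ, (∀ i j, S i j = S j i) ∧ (∀ h : Fin 3 → ℤ, ∑ s : Λ L M, Q (P (σ ⟨(Literature.MathematicalPhysics.QuantumFieldTheory.TorusChart.piProdZMod 2 L M).seam h, fun y μ _ hμ => (Literature.MathematicalPhysics.QuantumFieldTheory.TorusChart.piProdZMod 2 L M).seam_of_lt h y μ hμ⟩) s) = ∑ i : Fin 3, ∑ j : Fin 3, S i j * (h i : ℝ) * (h j : ℝ)) ∧ (∀ h : Fin 3 → ℤ, 8 * Real.pi ^ 2 * c₀ * (Fintype.card (Λ L M) : ℝ) * (((h 0 : ℤ) : ℝ) ^ 2 / (L : ℝ) ^ 2 + ((h 1 : ℤ) : ℝ) ^ 2 / (L : ℝ) ^ 2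 + ((h 2 : ℤ) : ℝ) ^ 2 / (M : ℝ) ^ 2) ≤ ∑ i : Fin 3, ∑ j : Fin 3, S i j * (h i : ℝ) * (h j : ℝ)) ∧ (∀ h : Fin 3 → ℤ, ∑ i : Fin 3, ∑ j : Fin 3, S i j * (h i : ℝ) * (h j : ℝ) ≤ (Fintype.card (Λ L M) : ℝ) * Q (fun w : W r => 2 * Real.pi * ((h 0 : ℝ) * ((w.1 : ℕ) : ℝ) / L + (h 1 : ℝ) * ((w.2.1 : ℕ) : ℝ) / L + (h 2 : ℝ) * ((w.2.2 : ℕ) : ℝ) / M))) ∧ (∀ (ℓ : (Λ L M → Fin 3 → ℝ) →ₗ[ℝ] ℝ) (h : Fin 3 → ℤ), ℓ (σ ⟨(Literature.MathematicalPhysics.QuantumFieldTheory.TorusChart.piProdZMod 2 L M).seam h, fun y μ _ hμ => (Literature.MathematicalPhysics.QuantumFieldTheory.TorusChart.piProdZMod 2 L M).seam_of_lt h y μ hμ⟩) = ∑ i : Fin 3, (h i : ℝ) * ℓ (σ ⟨(Literature.MathematicalPhysics.QuantumFieldTheory.TorusChart.piProdZMod 2 L M).seam (Pi.single i (1 : ℤ)),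 fun y μ _ hμ => (Literature.MathematicalPhysics.QuantumFieldTheory.TorusChart.piProdZMod 2 L M).seam_of_lt (Pi.single i (1 : ℤ)) y μ hμ⟩)) ∧ (∀ x : Fin 3 → ℝ, 8 * Real.pi ^ 2 * c₀ * (Fintype.card (Λ L M) : ℝ) * ((x 0) ^ 2 / (L : ℝ) ^ 2 + (x 1) ^ 2 / (L : ℝ) ^ 2 + (x 2) ^ 2 / (M : ℝ) ^ 2) ≤ ∑ i : Fin 3, ∑ j : Fin 3, S i j * x i * x j) ∧ (Matrix.of fun i j : Fin 3 => S i j).PosDef ∧ (∀ (K : ℝ), 0 < K → ∀ τ : Fin 3 → ℝ, 0 < ∑' h : Fin 3 → ℤ, Real.exp (-(K / 2 * ∑ s : Λ L M, Q (P (σ ⟨(Literature.MathematicalPhysics.QuantumFieldTheory.TorusChart.piProdZMod 2 L M).seam h, fun y μ _ hμ => (Literature.MathematicalPhysics.QuantumFieldTheory.TorusChart.piProdZMod 2 L M).seam_of_lt h y μ hμ⟩) s))) * Real.cos (∑ j : Fin 3, (h j : ℝ) * τ j)) := by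
  intro r c c₀ hr hc₀ hA hC L M _ _ P hP Q hQ σ hcls hpy
  obtain ⟨B, hBsymm, hBdiag⟩ := FSUnfolding.stub_thinFormPolar r c L M P hP Q hQ
  have hper0 : (TorusChart.piProdZMod 2 L M).period 0 = L := TorusChart.piProdZMod_period_castSucc 2 L M 0
  have hper1 : (TorusChart.piProdZMod 2 L M).period 1 = L := TorusChart.piProdZMod_period_castSucc 2 L M 1
  have hper2 : (TorusChart.piProdZMod 2 L M).period 2 = M := TorusChart.piProdZMod_period_last 2 L M
  -- the unit strains `v i := σ(seam eᵢ)` and the stiffness matrix `S i j := B (v i) (v j)`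
  set v : Fin 3 → (Λ L M → Fin 3 → ℝ) := fun i =>
    σ ⟨(TorusChart.piProdZMod 2 L M).seam (Pi.single i (1 : ℤ)), hth_seam_comb (Pi.single i (1 : ℤ))⟩ with hv
  have hsum : ∀ h : Fin 3 → ℤ, σ ⟨(TorusChart.piProdZMod 2 L M).seam h, hth_seam_comb h⟩ = ∑ i : Fin 3, (h i : ℝ) • v i :=
    fun h => hth_strain_seam_eq_sum c hr hc₀ hA hC P hP Q hQ σ hcls hpy h
  -- the thin form unfolded (for coercivity)
  have hQP : ∀ (η : Λ L M → Fin 3 → ℝ) (s : Λ L M), Q (P η s)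
      = (-c.sum (fun n a => a * (((∑ w : W r, (n w : ℝ) *
          ((TorusChart.piProdZMod 2 L M).lineSum η 0 (w.1 : ℕ) s
            + (TorusChart.piProdZMod 2 L M).lineSum η 1 (w.2.1 : ℕ) (s + (w.1 : ℕ) • (TorusChart.piProdZMod 2 L M).gen 0)
            + (TorusChart.piProdZMod 2 L M).lineSum η 2 (w.2.2 : ℕ)
              (s + (w.1 : ℕ) • (TorusChart.piProdZMod 2 L M).gen 0
                + (w.2.1 : ℕ) • (TorusChart.piProdZMod 2 L M).gen 1))) ^ 2 : ℝ) : ℂ))).re := by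
    intro η s; rw [hQ]; simp only [hP]
  -- (1) on integers
  have hquad : ∀ h : Fin 3 → ℤ, ∑ s : Λ L M, Q (P (σ ⟨(TorusChart.piProdZMod 2 L M).seam h, hth_seam_comb h⟩) s)
      = ∑ i : Fin 3, ∑ j : Fin 3, B (v i) (v j) * (h i : ℝ) * (h j : ℝ) := by
    intro h
    rw [← hBdiag, hsum h]
    exact hth_bilin_expand B _ _
  -- (5) coercivity on real vectors
  have hreal : ∀ x : Fin 3 → ℝ, 8 * Real.pi ^ 2 * c₀ * (Fintype.card (Λ L M) : ℝ)
      * ((x 0) ^ 2 / (L : ℝ) ^ 2 + (x 1) ^ 2 / (L : ℝ) ^ 2 + (x 2) ^ 2 / (M : ℝ) ^ 2)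
      ≤ ∑ i : Fin 3, ∑ j : Fin 3, B (v i) (v j) * x i * x j := by
    intro x
    set w : Λ L M → Fin 3 → ℝ := ∑ i : Fin 3, x i • v i with hw
    have hBw : ∑ i : Fin 3, ∑ j : Fin 3, B (v i) (v j) * x i * x j = ∑ s : Λ L M, Q (P w s) := by
      rw [← hBdiag, hw]
      exact (hth_bilin_expand B v x).symm
    rw [hBw]
    -- coercivity and Jensen
    have hcoer := FSUnfolding.stub_thinFormCoercive r c c₀ hr hc₀ hA hC L M w
    rw [← Finset.sum_congr rfl fun s _ => hQP w s] at hcoer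
    have hflux := scl_flux_le_sum_sq (Λ' := Λ L M) w
    -- the column totals of `w`
    have hcol : ∀ μ : Fin 3, ∑ y : Λ L M, w y μ
        = 2 * Real.pi * (Fintype.card (Λ L M) : ℝ) * x μ / ((TorusChart.piProdZMod 2 L M).period μ : ℝ) := by
      intro μ
      have hvi : ∀ i : Fin 3, ∑ y : Λ L M, v i y μ
          = 2 * Real.pi * ((Fintype.card (Λ L M) : ℝ) * (((Pi.single i (1 : ℤ) : Fin 3 → ℤ) μ : ℤ) : ℝ)
              / ((TorusChart.piProdZMod 2 L M).period μ : ℝ)) := fun i => ftp_sum_unitStrain σ hcls i μ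
      simp only [hw, Finset.sum_apply, Pi.smul_apply, smul_eq_mul]
      rw [Finset.sum_comm]
      simp only [← Finset.mul_sum, hvi, Fin.sum_univ_three]
      fin_cases μ <;> simp <;> ring
    have hcard : (0 : ℝ) < Fintype.card (Λ L M) := TorusChart.card_pos_real (Λ := Λ L M)
    have hfl : ∑ μ : Fin 3, (∑ y : Λ L M, w y μ) ^ 2 / (Fintype.card (Λ L M) : ℝ)
        = 4 * Real.pi ^ 2 * (Fintype.card (Λ L M) : ℝ)
          * ((x 0) ^ 2 / (L : ℝ) ^ 2 + (x 1) ^ 2 / (L : ℝ) ^ 2 + (x 2) ^ 2 / (M : ℝ) ^ 2) := by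
      rw [Fin.sum_univ_three, hcol 0, hcol 1, hcol 2, hper0, hper1, hper2]
      field_simp
      ring
    rw [hfl] at hflux
    nlinarith [hflux, hcoer, hc₀.le]
  -- (6) positive definiteness
  have hherm : (Matrix.of fun i j : Fin 3 => B (v i) (v j)).IsHermitian := by
    refine Matrix.IsHermitian.ext fun i j => ?_
    simp only [Matrix.of_apply, star_trivial]
    exact hBsymm _ _
  have hform : ∀ x : Fin 3 → ℝ, star x ⬝ᵥ ((Matrix.of fun i j : Fin 3 => B (v i) (v j)) *ᵥ x)
      = ∑ i : Fin 3, ∑ j : Fin 3, B (v i) (v j) * x i * x j := by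
    intro x
    simp only [star_trivial, dotProduct, Matrix.mulVec, Matrix.of_apply, Finset.mul_sum]
    exact Finset.sum_congr rfl fun i _ => Finset.sum_congr rfl fun j _ => by ring
  have hpd : (Matrix.of fun i j : Fin 3 => B (v i) (v j)).PosDef := by
    refine Matrix.PosDef.of_dotProduct_mulVec_pos hherm fun x hx => ?_
    rw [hform x]
    refine lt_of_lt_of_le ?_ (hreal x)
    have hL : (0 : ℝ) < L := by exact_mod_cast Nat.pos_of_ne_zero (NeZero.ne L)
    have hM : (0 : ℝ) < M := by exact_mod_cast Nat.pos_of_ne_zero (NeZero.ne M)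
    have hcard : (0 : ℝ) < Fintype.card (Λ L M) := TorusChart.card_pos_real (Λ := Λ L M)
    have hx' : 0 < (x 0) ^ 2 / (L : ℝ) ^ 2 + (x 1) ^ 2 / (L : ℝ) ^ 2 + (x 2) ^ 2 / (M : ℝ) ^ 2 := by
      by_contra hle
      push Not at hle
      have h0 : 0 ≤ (x 0) ^ 2 / (L : ℝ) ^ 2 := by positivity
      have h1 : 0 ≤ (x 1) ^ 2 / (L : ℝ) ^ 2 := by positivity
      have h2 : 0 ≤ (x 2) ^ 2 / (M : ℝ) ^ 2 := by positivity
      have e0 : x 0 = 0 := by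
        have : (x 0) ^ 2 / (L : ℝ) ^ 2 = 0 := by linarith
        rcases div_eq_zero_iff.1 this with h | h
        · exact pow_eq_zero_iff (n := 2) (by norm_num) |>.1 h
        · exact absurd h (by positivity)
      have e1 : x 1 = 0 := by
        have : (x 1) ^ 2 / (L : ℝ) ^ 2 = 0 := by linarith
        rcases div_eq_zero_iff.1 this with h | h
        · exact pow_eq_zero_iff (n := 2) (by norm_num) |>.1 h
        · exact absurd h (by positivity)
      have e2 : x 2 = 0 := by
        have : (x 2) ^ 2 / (M : ℝ) ^ 2 = 0 := by linarith
        rcases div_eq_zero_iff.1 this with h | h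
        · exact pow_eq_zero_iff (n := 2) (by norm_num) |>.1 h
        · exact absurd h (by positivity)
      apply hx
      funext i
      fin_cases i
      · exact e0
      · exact e1
      · exact e2
    positivity
  refine ⟨fun i j => B (v i) (v j), fun i j => hBsymm _ _, fun h => hquad h, fun h => ?_, fun h => ?_, fun ℓ h => ?_,
    hreal, hpd, fun K hK τ => ?_⟩
  · -- (2)
    rw [← hquad h]
    exact stub_windingSectorCostLower r c c₀ hr hc₀ hA hC L M P hP Q hQ h ((TorusChart.piProdZMod 2 L M).seam h)
      ((TorusChart.piProdZMod 2 L M).d₁_seam h) ((TorusChart.piProdZMod 2 L M).wind_seam h) _ (hcls _)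
  · -- (3)
    rw [← hquad h]
    exact FSUnfolding.stub_windingSectorCost r c c₀ hr hc₀ hA hC L M P hP Q hQ h ((TorusChart.piProdZMod 2 L M).seam h)
      ((TorusChart.piProdZMod 2 L M).d₁_seam h) ((TorusChart.piProdZMod 2 L M).wind_seam h) _ (hcls _) (hpy _)
  · -- (4)
    have hmem : (⟨(TorusChart.piProdZMod 2 L M).seam h, fun y μ _ hμ => (TorusChart.piProdZMod 2 L M).seam_of_lt h y μ hμ⟩ :
        {a : Λ L M → Fin 3 → ℤ // ∀ (y : Λ L M) (μ : Fin 3),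
          (∀ ν : Fin 3, μ < ν → (TorusChart.piProdZMod 2 L M).cval ν y = 0) →
          (TorusChart.piProdZMod 2 L M).cval μ y + 1 < (TorusChart.piProdZMod 2 L M).period μ → a y μ = 0})
        = ⟨(TorusChart.piProdZMod 2 L M).seam h, hth_seam_comb h⟩ := rfl
    rw [hmem, hsum h, map_sum]
    refine Finset.sum_congr rfl fun i _ => ?_
    rw [map_smul, smul_eq_mul]
  · -- (7) the tilted theta series
    have hpos := GaussianPoisson.tsum_exp_neg_half_form_mul_cos_pos (hpd.smul hK) τ
    convert hpos using 1
    refine tsum_congr fun h => ?_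
    have hmem : (⟨(TorusChart.piProdZMod 2 L M).seam h, fun y μ _ hμ => (TorusChart.piProdZMod 2 L M).seam_of_lt h y μ hμ⟩ :
        {a : Λ L M → Fin 3 → ℤ // ∀ (y : Λ L M) (μ : Fin 3),
          (∀ ν : Fin 3, μ < ν → (TorusChart.piProdZMod 2 L M).cval ν y = 0) →
          (TorusChart.piProdZMod 2 L M).cval μ y + 1 < (TorusChart.piProdZMod 2 L M).period μ → a y μ = 0})
        = ⟨(TorusChart.piProdZMod 2 L M).seam h, hth_seam_comb h⟩ := rfl
    rw [hmem, hquad h]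
    have e1 : ((fun j => (h j : ℝ)) ⬝ᵥ (K • Matrix.of fun i j : Fin 3 => B (v i) (v j)) *ᵥ fun j => (h j : ℝ))
        = K * ∑ i : Fin 3, ∑ j : Fin 3, B (v i) (v j) * (h i : ℝ) * (h j : ℝ) := by
      simp only [dotProduct, Matrix.mulVec, Matrix.smul_apply, Matrix.of_apply, smul_eq_mul, Finset.mul_sum]
      exact Finset.sum_congr rfl fun i _ => Finset.sum_congr rfl fun j _ => by ring
    rw [e1]
    congr 2
    ring

end FluxThetaPositive

end Summit.HubbardSuperconductivity.HubbardSuperconductivity.Theorems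

end
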